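import Literature.MathematicalPhysics.QuantumFieldTheory.Balaban1983to89.Beta.HessianTelescopingKKT

/-!
# T-TEL (the telescoping identity) — DESK MEMO: the line's THREE LEMMA SIGNATURES (seat `d1-tel-1`, gen 0; director-ym R576-ym (D)(2) / g18 (b))

NOT A TREE FILE (memo, `lean check`ed in the seat folder; published with `ledger crux write stmt-QuantumFields-20543 …`).  Statement level (and, as it turned out, sorry-free):
three NAMED declarations with explicit hypotheses over Mathlib matrices (S1, S2) and over the tree's typed kernel objects (S3), plus the
composition (S1 ∧ S2 are the finite-dimensional algebra; S3 is the dictionary; S3 ⟹ `D1Tel` BY NAME via the tree's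
`HessianTelescopingKKT.d1Tel_of_stepRecursion_wStep`).  The sorry-free versions of (S1), (S2) and their corollaries are filed as helpers
`Summits/QuantumFields/YangMills/Theorems/BalabanUVNodesK2D1Tel*.lean --supports stmt-QuantumFields-20543`.

HONEST FRAMING: typed ≠ proved.  (S1)/(S2) are textbook block-matrix algebra (Schur complement = congruence by the response graph;
Crabtree–Haynsworth quotient formula); (S3) is a PREDICATE over jet data — for Bałaban's (rooted) jets it is LAYER 2 of the β sub-cell's node P6
(road «FP» route T: periodise → factorise (`FP/NestedStepLawOneShot.secondVar_oneShot_nestedStepLaw`, in tree) → de-periodise), NOT proved here.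
Nothing of Bałaban's analysis is asserted; K2⁷ `EndpointGivenBR13SepCoPH` is NOT proved; the Yang–Mills mass gap is NOT proved.

SEARCH-AND-CITE (existing tree declarations this line consumes BY NAME, nothing restated):
* `Literature…Beta.Composition.kkt / blockProp / compForm / det_kkt_compForm / Chain.comp_invariant / Chain.logZ_total` — the constrained
  (bordered) composition law and its k-fold iterate («k steps = one k-fold step» for effective forms and Gaussian normalisations);
* `Literature…Beta.OneStepKernelFamily.KInvStep / TbalOf / TshotOf / D1Tel`, `…HidentScalewise.HessianTelescoping` — the typed kernels and T-TEL's
  tree name (`D1Tel Lc Js Jc := HessianTelescoping Lc (TbalOf Lc Js) (TshotOf Lc Jc)`);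
* `Literature…Beta.HessianTelescopingKKT.StepRecursion / wStep / d1Tel_of_stepRecursion_wStep` — the kernel-level one-step recursion and the
  canonical `ℋ`-column transport weight; `Summit…GAN24.T2RecursionAffine.lin4` — the linear part of the normalised second-order table recursion;
* `Summit…BalabanUV.Beta.D1BFx.LogDetSecondVariation.secondVar`, `FP/KKTCornerReduction.det_kkt_killRows`, `FP/NestedStepLawOneShot` — the
  matrix-level one-step law along `C²` background curves (road FP, in tree);
* `Literature/MathematicalPhysics/PowerSystems/KronReductionQuotientProperty.kronReduced_kronReduced` — the quotient property for SYMMETRIC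
  matrices with positive definite pivot (its header's `TODO(general form)` = (S2) below, now typed and — in the helper file — proved).
-/

namespace Summit.QuantumFields.YangMills.Theorems.BalabanUVNodesK2D1TelSignatures

open Matrix
open Literature.MathematicalPhysics.QuantumFieldTheory.Balaban1983to89.Beta
open OneStepResolventKernel (JetData)
open OneStepKernelFamily (TbalOf TshotOf D1Tel)
open HessianTelescopingKKT (StepRecursion wStep d1Tel_of_stepRecursion_wStep)

section MatrixLevel

variable {𝕜 : Type*} [CommRing 𝕜]
variable {α β γ δ : Type*} [Fintype α] [Fintype β] [Fintype γ] [Fintype δ]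
  [DecidableEq α] [DecidableEq β] [DecidableEq γ] [DecidableEq δ]

omit [Fintype α] [DecidableEq α] in
/-- **(S1) `stub_oneStep_schur` — ONE STEP = A SCHUR COMPLEMENT, one-leg form.**  Block form `M = [[A, B],[C, D]]` on (retained `α`) ⊕
(integrated `δ`), pivot `D` non-degenerate; `W : δ × α` the RESPONSE of the integrated block to the retained one (`D·W = −C`: the
stationarity / KKT row solved for the fluctuation — for the typed systems the `ℋ`-column of the packed resolvent).  THEN the one-step
effective form (the Schur complement `M/D = A − B·D⁻¹·C`) is `A + B·W`. [folklore] -/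
theorem stub_oneStep_schur (A : Matrix α α 𝕜) (B : Matrix α δ 𝕜) (C : Matrix δ α 𝕜) (D : Matrix δ δ 𝕜)
    (hD : IsUnit D.det) (W : Matrix δ α 𝕜) (hW : D * W = -C) :
    A - B * D⁻¹ * C = A + B * W := by
  have hW' : W = -(D⁻¹ * C) := by
    calc W = D⁻¹ * D * W := by rw [Matrix.nonsing_inv_mul D hD, Matrix.one_mul]
    _ = D⁻¹ * (D * W) := by rw [Matrix.mul_assoc]
    _ = -(D⁻¹ * C) := by rw [hW, Matrix.mul_neg]
  rw [hW', Matrix.mul_neg, ← Matrix.mul_assoc, sub_eq_add_neg]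

/-- **(S1′) `stub_oneStep_schur_congruence` — the same read as the CONGRUENCE OF THE FULL BLOCK FORM BY THE RESPONSE GRAPH on both
legs**: for the exact right response `W` (`D·W = −C`) and ANY left leg `V : α × δ` (in use: the left response `V·D = −B`, `V = Wᵀ` in the
symmetric case), `[1 | V] · M · [1 ; W] = M/D` — the lower block of `M·[1;W]` vanishes (stationarity), so the left dressing only reads the
retained block.  This is the matrix shape of the two-leg transport `DressedMomentNormalisation.dressedEntry` in `StepRecursion`. [folklore] -/
theorem stub_oneStep_schur_congruence (A : Matrix α α 𝕜) (B : Matrix α δ 𝕜) (C : Matrix δ α 𝕜) (D : Matrix δ δ 𝕜)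
    (hD : IsUnit D.det) (W : Matrix δ α 𝕜) (hW : D * W = -C) (V : Matrix α δ 𝕜) :
    fromCols (1 : Matrix α α 𝕜) V * fromBlocks A B C D * fromRows (1 : Matrix α α 𝕜) W = A - B * D⁻¹ * C := by
  rw [Matrix.mul_assoc, fromBlocks_mul_fromRows, fromCols_mul_fromRows, hW, Matrix.mul_one, Matrix.mul_one, add_neg_cancel,
    Matrix.mul_zero, add_zero, Matrix.one_mul, stub_oneStep_schur A B C D hD W hW]

omit [Fintype α] [DecidableEq α] in
/-- **(S2) `stub_quotient` — THE ITERATED SCHUR COMPLEMENT IS THE SCHUR COMPLEMENT (Crabtree–Haynsworth quotient formula, general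
form: any commutative ring, NON-SINGULAR nested pivots).**  Three levels: retained `α`, first-integrated `β`, second-integrated `γ`;
`M = [[A, B₁, B₂],[C₁, D₁₁, D₁₂],[C₂, D₂₁, D₂₂]]`.  If `D₂₂` and the intermediate effective form `D₁₁ − D₁₂D₂₂⁻¹D₂₁` (= `D/D₂₂`) are
non-degenerate, then eliminating `γ` and then `β` (two RG steps) equals eliminating `β ⊕ γ` at once (the one-shot step):
`M/D = (M/D₂₂)/(D/D₂₂)` (Horn–Johnson, *Matrix Analysis* 2nd ed. §0.8.5 (0.8.5.12); F. Zhang (ed.), *The Schur complement and its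
applications* (2005) Thm 1.4, Crabtree–Haynsworth 1969). [folklore] -/
theorem stub_quotient (A : Matrix α α 𝕜) (B₁ : Matrix α β 𝕜) (B₂ : Matrix α γ 𝕜) (C₁ : Matrix β α 𝕜) (C₂ : Matrix γ α 𝕜)
    (D₁₁ : Matrix β β 𝕜) (D₁₂ : Matrix β γ 𝕜) (D₂₁ : Matrix γ β 𝕜) (D₂₂ : Matrix γ γ 𝕜)
    (h₂₂ : IsUnit D₂₂.det) (h₁ : IsUnit (D₁₁ - D₁₂ * D₂₂⁻¹ * D₂₁).det) :
    A - fromCols B₁ B₂ * (fromBlocks D₁₁ D₁₂ D₂₁ D₂₂)⁻¹ * fromRows C₁ C₂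
      = (A - B₂ * D₂₂⁻¹ * C₂)
        - (B₁ - B₂ * D₂₂⁻¹ * D₂₁) * (D₁₁ - D₁₂ * D₂₂⁻¹ * D₂₁)⁻¹ * (C₁ - D₁₂ * D₂₂⁻¹ * C₂) := by
  letI : Invertible D₂₂ := invertibleOfIsUnitDet _ h₂₂
  have hS' : D₁₁ - D₁₂ * D₂₂⁻¹ * D₂₁ = D₁₁ - D₁₂ * ⅟D₂₂ * D₂₁ := by rw [invOf_eq_nonsing_inv]
  letI : Invertible (D₁₁ - D₁₂ * ⅟D₂₂ * D₂₁) := (invertibleOfIsUnitDet _ h₁).copy _ hS'.symm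
  letI : Invertible (fromBlocks D₁₁ D₁₂ D₂₁ D₂₂) := fromBlocks₂₂Invertible _ _ _ _
  rw [← invOf_eq_nonsing_inv (fromBlocks D₁₁ D₁₂ D₂₁ D₂₂), invOf_fromBlocks₂₂_eq, fromCols_mul_fromBlocks, fromCols_mul_fromRows]
  simp only [invOf_eq_nonsing_inv]
  generalize (D₁₁ - D₁₂ * D₂₂⁻¹ * D₂₁)⁻¹ = X
  generalize D₂₂⁻¹ = Y
  simp only [Matrix.mul_add, Matrix.add_mul, Matrix.mul_sub, Matrix.sub_mul, Matrix.mul_neg, Matrix.neg_mul, Matrix.mul_assoc]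
  abel

end MatrixLevel

section KernelLevel

variable (Lc : ℕ) [NeZero Lc]

/-- **(S3) `stub_dictionary` — THE ROOTED TABLES ARE THAT BLOCK FORM'S ENTRIES**, stated in the tree's kernel vocabulary as the predicate the
dictionary must deliver for a pair (step jets `Js`, composite jets `Jc`): (base) the one-shot kernel of ONE step is the step-`0` kernel, and
(step) the ONE-STEP TRANSPORT RECURSION with the canonical `ℋ`-column weight — `TshotOf Lc Jc (j+1) = Lc⁸ · (wStepᵀ · TshotOf Lc Jc j · wStep)(Lc•·) + TbalOf Lc Js j`
(`HessianTelescopingKKT.StepRecursion … (wStep Lc)`), i.e. the second background-derivative of the pointwise composition law whose matrix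
skeleton is (S1) ∧ (S2).  For Bałaban's ROOTED jets (road FP's record: rooted charts `ARoot j`, `wStep` transport, rooted graded tables,
value-jet members; END `TowerKernelLawNamedRooted`, d1-p3 g66) this IS the open LAYER-2 identification (periodise → factorise by
`FP/NestedStepLawOneShot` → de-periodise); Engine C's relays (445)/(446) check its `m = 2` instance numerically at `(p, Lc) = (2, 3)`.
A PREDICATE, never a fact. [folklore] -/
def StubDictionary (Js : ℕ → JetData 3 Lc) (Jc : ∀ m : ℕ, JetData 3 (Lc ^ m)) : Prop :=
  TshotOf Lc Jc 1 = TbalOf Lc Js 0 ∧ StepRecursion Lc (TbalOf Lc Js) (TshotOf Lc Jc) (wStep Lc)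

/-- **COMPOSITION (BY NAME, PROVED): (S3) + the step kernels' Ward data (T0)/(T1) ⟹ T-TEL** `D1Tel Lc Js Jc` for EVERY blocking `Lc`
(`NeZero`; `Lc ≥ 2` in use) and ALL scales — `HessianTelescopingKKT.d1Tel_of_stepRecursion_wStep`. [folklore] -/
theorem d1Tel_of_stubDictionary (Js : ℕ → JetData 3 Lc) (Jc : ∀ m : ℕ, JetData 3 (Lc ^ m))
    (hT0 : ∀ j (c e : Fin 4), HasSum (TbalOf Lc Js j c e) 0)
    (hT1 : ∀ j (c e ρ : Fin 4), HasSum (fun t : Fin 4 → ℤ => t ρ • TbalOf Lc Js j c e t) 0)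
    (h : StubDictionary Lc Js Jc) : D1Tel Lc Js Jc :=
  d1Tel_of_stepRecursion_wStep Js Jc hT0 hT1 h.1 h.2

end KernelLevel

end Summit.QuantumFields.YangMills.Theorems.BalabanUVNodesK2D1TelSignatures
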